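import Literature.IUT.LogVolume.Corollary22PartIIPointwise
import Literature.NumberTheory.Multiplicative.ChebyshevThetaExplicit
import Literature.NumberTheory.LFunctions.ChebyshevPsiExplicit
import Mathlib.Analysis.Complex.ExponentialBounds
import HarnessLib

/-!
# [IUTchIV] Corollary 2.2 (ii), prime-choice step (P1)–(P3) (pp. 44–45) — EFFECTIVE form: «h^{1/2} ≥ 5» suffices

Mochizuki, *Inter-universal Teichmüller theory IV*, proof of Cor. 2.2 (ii), pp. 44–45: given the local heights `h_v`,
residue degrees `f_v`, residue characteristics `p_v` over the bad places, `[F:ℚ] = d ≤ δ`, `h = log(q^∀)` with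
`d·h = Σ_v h_v·f_v·log(p_v)`, and «h^{1/2} ≥ ξ_prm» for the constant `ξ_prm ≥ 5` of Prop. 2.1 (ii), there is a prime `l` with
(P1) `h^{1/2} ≤ l ≤ 10δ·h^{1/2}·log(2δ·h)`, (P2) `l ∤ h_v` for `h_v ≠ 0`, (P3) `p_v = l ⟹ h_v < h^{1/2}`. The tree proves this as
`Cor22.PrimeChoiceData.exists_prime_P1_P2_P3` (`Corollary22PrimeChoice.lean`), whose carrier bundles `ξ_prm` with `IsXiPrm ξ_prm`
— an INEFFECTIVE constant (`exists_isXiPrm`, from the prime number theorem) — and, at an NF-point, as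
`Cor22.exists_prime_P1_P2_P3_point (hξ : IsXiPrm ξ) (hξh : ξ ≤ (log q^∀)^{1/2})`.

THIS FILE (proof-only; no definition, no new `Prop` fact) proves the SAME conclusions from «h^{1/2} ≥ 5» ALONE:
* `Cor22.exists_prime_P1_P2_P3_of_five_le_sqrt` — carrier-free, over the raw data `(V, h_v, f_v, p_v, d ≤ δ, h)`;
* `Cor22.exists_prime_P1_P2_P3_point_of_five_le_sqrt` — at an NF-point `λ` with `P.degree ≤ d`, hypothesis
  `5 ≤ (log q^∀(λ))^{1/2}` only (same conclusion as `exists_prime_P1_P2_P3_point`, including `CondP2`).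
So the prime-choice step needs no `ξ_prm`: the threshold in «h^{1/2} ≥ ξ_prm ≥ 5» can be taken to be the printed `5`
(EFFECTIVE exceptional set for this step). Independently, §0 records an EFFECTIVE `ξ_prm` for Prop. 2.1 (ii) itself:
`isXiPrm_million : IsXiPrm 10⁶` from the tree's Chebyshev-1852 bounds `0.9166·n ≤ θ(n) ≤ 1.107·n` (`n ≥ 10⁶`,
`Literature.NumberTheory.LFunctions.ChebyshevExplicit.theta_ge_9166` / `theta_le_1107`), so every consumer of
`exists_isXiPrm` (ineffective, PNT) may take `ξ_prm := 10⁶`. ROUTE: `ξ_prm` enters the printed proof twice — (S1) `θ(h^{1/2}) ≤ (4/3)·h^{1/2}` and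
the final «there exists a prime p ∉ A with p ≤ 2(θ_A + ξ_prm)». Replace (S1) by Mathlib's Chebyshev bound `θ(x) ≤ (log 4)·x`
(`Chebyshev.theta_le_log4_mul_x`) and the final step by the EFFECTIVE prime-avoidance lemma
`Literature.NumberTheory.Multiplicative.exists_prime_not_mem_le_of_sum_log_lt_quarter` (`θ(x) ≥ x/4` for `x ≥ 3`, proved in the
tree): with `s = h^{1/2} ≥ 5`, `δ ≥ 2`, `L = log(2δh) ≥ 4` one has `θ_A ≤ (log 4)·s + δ·s + 2δ·s·L < (10·δ·s·L)/4 ≤ θ(10·δ·s·L)`.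
(S2), (S3) are the counting estimates of p. 44, re-proved here over the raw data (the tree's versions live on the `ξ`-carrier).
The same route was used for Joshi's restatement [J-IV] Lem. 5.8.7 (`Summits/ABC/IUTFork/Joshi/ATS4ExistenceLemmasAsPrinted.lean`).

[claim: Mochizuki2012, status: disputed] for the (P1)–(P3) statements as printed (they are PROVED here — classical analytic
number theory, no IUT input); helper estimates [folklore]. Standard axioms only.
-/

noncomputable section

open Real Finset
open scoped Chebyshev
open NumberField IsDedekindDomain Literature.NumberTheory.DiophantineGeometry.GenEll
open Literature.NumberTheory.Multiplicative

namespace Literature.IUT.LogVolume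

/-! ## 0. An EFFECTIVE `ξ_prm` for [IUTchIV] Prop. 2.1 (ii): `ξ_prm = 10⁶` -/

/-- **[IUTchIV] Prop. 2.1 (ii) with an EXPLICIT constant**: `IsXiPrm 10⁶`, i.e. `(2/3)·x ≤ θ(x) ≤ (4/3)·x` for all real
`x ≥ 10⁶` — from the tree's Chebyshev bounds `0.9166·n ≤ θ(n) ≤ 1.107·n` for `n ≥ 10⁶` (at `n = ⌊x⌋`, `θ(x) = θ(⌊x⌋)`,
`x − 1 < ⌊x⌋ ≤ x`). The tree's `exists_isXiPrm` is the ineffective PNT form of the same sentence.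
[claim: Mochizuki2012, status: disputed] -/
theorem isXiPrm_million : IsXiPrm (1000000 : ℝ) := by
  refine ⟨by norm_num, fun x hx => ?_⟩
  have hx0 : 0 ≤ x := by linarith
  have hfloor : 10 ^ 6 ≤ ⌊x⌋₊ := Nat.le_floor (by norm_num; linarith)
  rw [Chebyshev.theta_eq_theta_coe_floor x]
  have hlo := Literature.NumberTheory.LFunctions.ChebyshevExplicit.theta_ge_9166 hfloor
  have hhi := Literature.NumberTheory.LFunctions.ChebyshevExplicit.theta_le_1107 hfloor
  have h1 : (⌊x⌋₊ : ℝ) ≤ x := Nat.floor_le hx0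
  have h2 : x < ⌊x⌋₊ + 1 := Nat.lt_floor_add_one x
  constructor <;> linarith

/-- Hence an EFFECTIVE witness for `exists_isXiPrm`. [claim: Mochizuki2012, status: disputed] -/
theorem exists_isXiPrm_effective : ∃ ξ_prm : ℝ, ξ_prm ≤ 1000000 ∧ IsXiPrm ξ_prm := ⟨1000000, le_rfl, isXiPrm_million⟩

namespace Cor22

section CarrierFree

variable {ι : Type} {V : Finset ι} {hv fv pv : ι → ℕ} {d : ℕ} {δ h : ℝ}

/-- `h^{1/2} ≥ 5 ⟹ h > 0`, `h ≥ 25`, `(√h)² = h`. [folklore] -/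
private theorem h_facts (h5 : 5 ≤ Real.sqrt h) : 0 < h ∧ 25 ≤ h ∧ Real.sqrt h ^ 2 = h := by
  have hh0 : 0 < h := by
    by_contra hle
    rw [not_lt] at hle
    rw [Real.sqrt_eq_zero'.mpr hle] at h5
    linarith
  have hsq : Real.sqrt h ^ 2 = h := Real.sq_sqrt hh0.le
  exact ⟨hh0, by nlinarith, hsq⟩

/-- `h^{1/2} ≥ 5`, `δ ≥ 2 ⟹ log(2δh) ≥ 4` (`2δh ≥ 100 > e⁴`). [folklore] -/
private theorem four_le_log (hδ : 2 ≤ δ) (h5 : 5 ≤ Real.sqrt h) : 4 ≤ Real.log (2 * δ * h) := by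
  obtain ⟨_, hh, _⟩ := h_facts h5
  have h100 : (100 : ℝ) ≤ 2 * δ * h := by nlinarith
  rw [Real.le_log_iff_exp_le (by linarith)]
  have he : Real.exp 4 = Real.exp 1 ^ 4 := by rw [Real.exp_one_pow]; norm_num
  have h1 := Real.exp_one_lt_d9
  have h0 := Real.exp_pos 1
  have : Real.exp 1 ^ 4 < 2.7182818286 ^ 4 := by gcongr
  nlinarith

/-- Each term `h_v·f_v·log(p_v)` is `≥ 0`. [folklore] -/
private theorem term_nonneg' (v : ι) : 0 ≤ (hv v : ℝ) * (fv v : ℝ) * Real.log (pv v) := by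
  have := Real.log_natCast_nonneg (pv v); positivity

/-- **(S3) from «h^{1/2} ≥ 5»** ([IUTchIV] Cor. 2.2 (ii) proof, p. 44): `Σ_{h_v ≥ h^{1/2}} log(p_v) ≤ δ·h^{1/2}` (carrier-free twin of
`PrimeChoiceData.sum_log_pv_le`). [claim: Mochizuki2012, status: disputed] -/
theorem sum_log_pv_le_of_five_le_sqrt (one_le_fv : ∀ v ∈ V, 1 ≤ fv v) (d_le_δ : (d : ℝ) ≤ δ)
    (h_def : (d : ℝ) * h = ∑ v ∈ V, (hv v : ℝ) * (fv v : ℝ) * Real.log (pv v)) (h5 : 5 ≤ Real.sqrt h) :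
    ∑ v ∈ V.filter (fun v => Real.sqrt h ≤ hv v), Real.log (pv v : ℝ) ≤ δ * Real.sqrt h := by
  obtain ⟨hh0, _, hsq⟩ := h_facts h5
  have hs0 : 0 < Real.sqrt h := by linarith
  set W := V.filter (fun v => Real.sqrt h ≤ hv v) with hW
  have h1 : Real.sqrt h * ∑ v ∈ W, Real.log (pv v : ℝ) ≤ ∑ v ∈ W, (hv v : ℝ) * (fv v : ℝ) * Real.log (pv v) := by
    rw [Finset.mul_sum]
    refine Finset.sum_le_sum fun v hvW => ?_
    rw [hW, Finset.mem_filter] at hvW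
    have hf : (1 : ℝ) ≤ fv v := by exact_mod_cast one_le_fv v hvW.1
    have hl : 0 ≤ Real.log (pv v : ℝ) := Real.log_natCast_nonneg _
    have ea : Real.sqrt h * Real.log (pv v) ≤ (hv v : ℝ) * Real.log (pv v) := mul_le_mul_of_nonneg_right hvW.2 hl
    have eb : (hv v : ℝ) * Real.log (pv v) * 1 ≤ (hv v : ℝ) * Real.log (pv v) * (fv v : ℝ) :=
      mul_le_mul_of_nonneg_left hf (mul_nonneg (by positivity) hl)
    have e : (hv v : ℝ) * (fv v : ℝ) * Real.log (pv v) = (hv v : ℝ) * Real.log (pv v) * (fv v : ℝ) := by ring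
    rw [e]; linarith
  have h2 : ∑ v ∈ W, (hv v : ℝ) * (fv v : ℝ) * Real.log (pv v) ≤ (d : ℝ) * h := by
    rw [h_def]
    exact Finset.sum_le_sum_of_subset_of_nonneg (Finset.filter_subset _ _) fun v _ _ => term_nonneg' v
  have h3 : (d : ℝ) * h ≤ δ * h := mul_le_mul_of_nonneg_right d_le_δ hh0.le
  have h4 : δ * h = δ * Real.sqrt h * Real.sqrt h := by rw [mul_assoc, ← sq, hsq]
  have : Real.sqrt h * ∑ v ∈ W, Real.log (pv v : ℝ) ≤ (δ * Real.sqrt h) * Real.sqrt h := by linarith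
  rw [mul_comm] at this
  exact le_of_mul_le_mul_right this hs0

/-- **(S2) from «h^{1/2} ≥ 5»** ([IUTchIV] Cor. 2.2 (ii) proof, p. 44 «h_v^{1/2}·log(h_v) ≤ …»): `Σ_{h_v ≥ h^{1/2}} log(h_v) ≤
2δ·h^{1/2}·log(2δ·h)` (carrier-free twin of `PrimeChoiceData.sum_log_hv_le`). [claim: Mochizuki2012, status: disputed] -/
theorem sum_log_hv_le_of_five_le_sqrt (one_le_fv : ∀ v ∈ V, 1 ≤ fv v) (pv_prime : ∀ v ∈ V, (pv v).Prime)
    (two_le_δ : 2 ≤ δ) (d_le_δ : (d : ℝ) ≤ δ)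
    (h_def : (d : ℝ) * h = ∑ v ∈ V, (hv v : ℝ) * (fv v : ℝ) * Real.log (pv v)) (h5 : 5 ≤ Real.sqrt h) :
    ∑ v ∈ V.filter (fun v => Real.sqrt h ≤ hv v), Real.log (hv v : ℝ) ≤ 2 * δ * Real.sqrt h * Real.log (2 * δ * h) := by
  obtain ⟨hh0, _, hsq⟩ := h_facts h5
  have hs0 : 0 < Real.sqrt h := by linarith
  have hlog1 : 1 ≤ Real.log (2 * δ * h) := le_trans (by norm_num) (four_le_log two_le_δ h5)
  set W := V.filter (fun v => Real.sqrt h ≤ hv v) with hW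
  have hterm : ∀ v ∈ W, Real.sqrt h * Real.log (hv v) ≤
      2 * ((hv v : ℝ) * (fv v : ℝ) * Real.log (pv v)) * Real.log (2 * δ * h) := by
    intro v hvW
    rw [hW, Finset.mem_filter] at hvW
    obtain ⟨hvV, hge⟩ := hvW
    have ha1 : (1 : ℝ) ≤ hv v := by linarith
    have hloga : 0 ≤ Real.log (hv v : ℝ) := Real.log_nonneg ha1
    have hf : (1 : ℝ) ≤ fv v := by exact_mod_cast one_le_fv v hvV
    have hp2 : (2 : ℝ) ≤ pv v := by exact_mod_cast (pv_prime v hvV).two_le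
    have hlogp : 1 ≤ 2 * Real.log (pv v : ℝ) := by
      have h22 : Real.log 4 ≤ Real.log ((pv v : ℝ) ^ 2) := Real.log_le_log (by norm_num) (by nlinarith)
      rw [Real.log_pow] at h22
      have h4 : 1 ≤ Real.log (4 : ℝ) := by
        have he : Real.exp 1 ≤ 4 := by have := Real.exp_one_lt_d9; linarith
        calc (1 : ℝ) = Real.log (Real.exp 1) := (Real.log_exp 1).symm
          _ ≤ Real.log 4 := Real.log_le_log (Real.exp_pos 1) he
      push_cast at h22; linarith
    have hterm_le : (hv v : ℝ) * (fv v : ℝ) * Real.log (pv v) ≤ (d : ℝ) * h := by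
      rw [h_def]
      exact Finset.single_le_sum (fun w _ => term_nonneg' w) hvV
    have hale : (hv v : ℝ) ≤ 2 * δ * h := by
      have e1 : (hv v : ℝ) * 1 ≤ (hv v : ℝ) * ((fv v : ℝ) * (2 * Real.log (pv v))) := by
        apply mul_le_mul_of_nonneg_left _ (by positivity); nlinarith
      have e3 := mul_le_mul_of_nonneg_right d_le_δ hh0.le
      nlinarith
    have hloga_le : Real.log (hv v : ℝ) ≤ Real.log (2 * δ * h) := Real.log_le_log (by linarith) hale
    have a1 : Real.sqrt h * Real.log (hv v) ≤ (hv v : ℝ) * Real.log (hv v) := mul_le_mul_of_nonneg_right hge hloga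
    have a2 : (hv v : ℝ) * Real.log (hv v) ≤ (hv v : ℝ) * Real.log (2 * δ * h) :=
      mul_le_mul_of_nonneg_left hloga_le (by positivity)
    have a3 : (hv v : ℝ) * Real.log (2 * δ * h) ≤ (hv v : ℝ) * ((fv v : ℝ) * (2 * Real.log (pv v))) * Real.log (2 * δ * h) := by
      have : (hv v : ℝ) ≤ (hv v : ℝ) * ((fv v : ℝ) * (2 * Real.log (pv v))) := by
        have : (1 : ℝ) ≤ (fv v : ℝ) * (2 * Real.log (pv v)) := by nlinarith
        nlinarith
      exact mul_le_mul_of_nonneg_right this (by linarith)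
    nlinarith
  have hsum : Real.sqrt h * ∑ v ∈ W, Real.log (hv v : ℝ) ≤
      2 * (∑ v ∈ W, (hv v : ℝ) * (fv v : ℝ) * Real.log (pv v)) * Real.log (2 * δ * h) := by
    rw [Finset.mul_sum, Finset.mul_sum, Finset.sum_mul]
    exact Finset.sum_le_sum hterm
  have hsub : ∑ v ∈ W, (hv v : ℝ) * (fv v : ℝ) * Real.log (pv v) ≤ (d : ℝ) * h := by
    rw [h_def]
    exact Finset.sum_le_sum_of_subset_of_nonneg (Finset.filter_subset _ _) fun v _ _ => term_nonneg' v
  have hd : (d : ℝ) * h ≤ δ * h := mul_le_mul_of_nonneg_right d_le_δ hh0.le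
  have hfinal : Real.sqrt h * ∑ v ∈ W, Real.log (hv v : ℝ) ≤ (2 * δ * Real.sqrt h * Real.log (2 * δ * h)) * Real.sqrt h := by
    have e1 : 2 * ((d : ℝ) * h) * Real.log (2 * δ * h) ≤ 2 * (δ * h) * Real.log (2 * δ * h) := by nlinarith
    have e : 2 * (δ * h) * Real.log (2 * δ * h) = (2 * δ * Real.sqrt h * Real.log (2 * δ * h)) * Real.sqrt h := by
      linear_combination (2 * δ * Real.log (2 * δ * h)) * hsq.symm
    nlinarith [Finset.sum_nonneg (fun v (_ : v ∈ W) => term_nonneg' (hv := hv) (fv := fv) (pv := pv) v)]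
  rw [mul_comm] at hfinal
  exact le_of_mul_le_mul_right hfinal hs0

/-- `Σ_{p ∈ ⋃_{x∈s} t(x)} g(p) ≤ Σ_{x∈s} Σ_{p∈t(x)} g(p)` for `g ≥ 0`. [folklore] -/
private theorem sum_biUnion_le' {κ : Type*} (s : Finset κ) (t : κ → Finset ℕ) (g : ℕ → ℝ) (hg : ∀ n, 0 ≤ g n) :
    ∑ q ∈ s.biUnion t, g q ≤ ∑ x ∈ s, ∑ q ∈ t x, g q := by
  classical
  induction s using Finset.induction_on with
  | empty => simp
  | insert a s ha ih =>
    rw [Finset.biUnion_insert, Finset.sum_insert ha]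
    have hu : ∑ q ∈ t a ∪ s.biUnion t, g q ≤ ∑ q ∈ t a, g q + ∑ q ∈ s.biUnion t, g q := by
      rw [← Finset.sum_union_inter]
      have : 0 ≤ ∑ q ∈ t a ∩ s.biUnion t, g q := Finset.sum_nonneg fun q _ => hg q
      linarith
    linarith

/-- `Σ_{A ∪ B} g ≤ Σ_A g + Σ_B g` for `g ≥ 0`. [folklore] -/
private theorem sum_union_le' (A B : Finset ℕ) (g : ℕ → ℝ) (hg : ∀ n, 0 ≤ g n) :
    ∑ q ∈ A ∪ B, g q ≤ ∑ q ∈ A, g q + ∑ q ∈ B, g q := by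
  rw [← Finset.sum_union_inter]
  have : 0 ≤ ∑ q ∈ A ∩ B, g q := Finset.sum_nonneg fun q _ => hg q
  linarith

/-- For `n ≥ 1`: `Σ_{p | n} log p ≤ log n`. [folklore] -/
private theorem sum_log_primeFactors_le' {n : ℕ} (hn : n ≠ 0) : ∑ q ∈ n.primeFactors, Real.log q ≤ Real.log n := by
  have hprod : (∏ q ∈ n.primeFactors, (q : ℝ)) = ((∏ q ∈ n.primeFactors, q : ℕ) : ℝ) := by push_cast; rfl
  rw [← Real.log_prod (s := n.primeFactors) (f := fun q : ℕ => (q : ℝ))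
    (fun q hq => by exact_mod_cast (Nat.prime_of_mem_primeFactors hq).ne_zero), hprod]
  apply Real.log_le_log
  · exact_mod_cast Finset.prod_pos fun q hq => (Nat.prime_of_mem_primeFactors hq).pos
  · exact_mod_cast Nat.le_of_dvd (Nat.pos_of_ne_zero hn) (Nat.prod_primeFactors_dvd n)

/-- The numerical heart: `(log 4)·s + δ·s + 2δ·s·L < (10·δ·s·L)/4` for `s > 0`, `δ ≥ 2`, `L ≥ 4`. [folklore] -/
private theorem key_ineq' {s L : ℝ} (hs : 0 < s) (hδ : 2 ≤ δ) (hL : 4 ≤ L) :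
    Real.log 4 * s + δ * s + 2 * δ * s * L < 10 * δ * s * L / 4 := by
  have hl4 : Real.log 4 < 2 := by
    have : Real.log 4 = 2 * Real.log 2 := by
      rw [show (4 : ℝ) = 2 ^ 2 by norm_num, Real.log_pow]; norm_num
    rw [this]; have := Real.log_two_lt_d9; linarith
  have h1 : 0 ≤ δ * s * (L - 4) := mul_nonneg (mul_nonneg (by linarith) hs.le) (by linarith)
  have h2 : 0 < s * (δ - Real.log 4) := mul_pos hs (by linarith)
  nlinarith [h1, h2]

/-- **[IUTchIV] Cor. 2.2 (ii), proof, (P1)–(P3) (pp. 44–45) — EFFECTIVE**: for raw data `(V, h_v, f_v, p_v, d ≤ δ, h)` with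
`f_v ≥ 1`, `p_v` prime, `δ ≥ 2`, `d·h = Σ_v h_v·f_v·log(p_v)` and ONLY «h^{1/2} ≥ 5» (no `ξ_prm`), there is a prime `l` with
(P1) `h^{1/2} ≤ l ≤ 10δ·h^{1/2}·log(2δ·h)`, (P2) `l ∤ h_v` for `h_v ≠ 0`, (P3) `p_v = l ⟹ h_v < h^{1/2}`.
[claim: Mochizuki2012, status: disputed] -/
theorem exists_prime_P1_P2_P3_of_five_le_sqrt (one_le_fv : ∀ v ∈ V, 1 ≤ fv v) (pv_prime : ∀ v ∈ V, (pv v).Prime)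
    (two_le_δ : 2 ≤ δ) (d_le_δ : (d : ℝ) ≤ δ)
    (h_def : (d : ℝ) * h = ∑ v ∈ V, (hv v : ℝ) * (fv v : ℝ) * Real.log (pv v)) (h5 : 5 ≤ Real.sqrt h) :
    ∃ l : ℕ, l.Prime ∧ Real.sqrt h ≤ l ∧ (l : ℝ) ≤ 10 * δ * Real.sqrt h * Real.log (2 * δ * h) ∧
      (∀ v ∈ V, hv v ≠ 0 → ¬ l ∣ hv v) ∧ (∀ v ∈ V, pv v = l → (hv v : ℝ) < Real.sqrt h) := by
  have hs0 : 0 < Real.sqrt h := by linarith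
  have hL := four_le_log two_le_δ h5
  have hg : ∀ n : ℕ, 0 ≤ Real.log (n : ℝ) := fun n => Real.log_natCast_nonneg n
  -- the excluded set `A = (S1) ∪ (S2′) ∪ (S3)`
  set W := V.filter (fun v => Real.sqrt h ≤ hv v) with hW
  set S1 : Finset ℕ := Nat.primesLE ⌊Real.sqrt h⌋₊ with hS1
  set S2 : Finset ℕ := W.biUnion (fun v => (hv v).primeFactors) with hS2
  set S3 : Finset ℕ := W.image pv with hS3
  -- `θ_A ≤ (log 4)·s + δ·s + 2δ·s·L`
  have hθ : ∑ q ∈ S1 ∪ S2 ∪ S3, Real.log (q : ℝ) ≤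
      Real.log 4 * Real.sqrt h + δ * Real.sqrt h + 2 * δ * Real.sqrt h * Real.log (2 * δ * h) := by
    have h1 : ∑ q ∈ S1, Real.log (q : ℝ) ≤ Real.log 4 * Real.sqrt h := by
      have hθ1 : θ (Real.sqrt h) = ∑ q ∈ S1, Real.log (q : ℝ) := by rw [Chebyshev.theta_eq_sum_primesLE]
      rw [← hθ1]
      exact Chebyshev.theta_le_log4_mul_x hs0.le
    have h2 : ∑ q ∈ S2, Real.log (q : ℝ) ≤ 2 * δ * Real.sqrt h * Real.log (2 * δ * h) := by
      refine le_trans (sum_biUnion_le' W _ _ hg) (le_trans (Finset.sum_le_sum fun v hvW => ?_)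
        (sum_log_hv_le_of_five_le_sqrt one_le_fv pv_prime two_le_δ d_le_δ h_def h5))
      have hv' : Real.sqrt h ≤ (hv v : ℝ) := (Finset.mem_filter.mp hvW).2
      exact sum_log_primeFactors_le' (by intro h0; rw [h0] at hv'; push_cast at hv'; linarith)
    have h3 : ∑ q ∈ S3, Real.log (q : ℝ) ≤ δ * Real.sqrt h :=
      le_trans (Finset.sum_image_le_of_nonneg fun q _ => Real.log_natCast_nonneg q)
        (sum_log_pv_le_of_five_le_sqrt one_le_fv d_le_δ h_def h5)
    have hu1 := sum_union_le' (S1 ∪ S2) S3 _ hg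
    have hu2 := sum_union_le' S1 S2 _ hg
    linarith
  -- `θ_A < X/4 ≤ θ(X)` for `X = 10δ·s·L ≥ 3`, so some prime `l ≤ X` avoids `A`
  have hlt : ∑ q ∈ S1 ∪ S2 ∪ S3, Real.log (q : ℝ) < 10 * δ * Real.sqrt h * Real.log (2 * δ * h) / 4 :=
    lt_of_le_of_lt hθ (key_ineq' hs0 two_le_δ hL)
  have h3X : (3 : ℝ) ≤ 10 * δ * Real.sqrt h * Real.log (2 * δ * h) := by
    have e1 : (2 : ℝ) * 5 ≤ δ * Real.sqrt h := mul_le_mul two_le_δ h5 (by norm_num) (by linarith)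
    have e2 : δ * Real.sqrt h * 4 ≤ δ * Real.sqrt h * Real.log (2 * δ * h) := mul_le_mul_of_nonneg_left hL (by positivity)
    nlinarith
  obtain ⟨l, hlp, hlA, hlle⟩ := exists_prime_not_mem_le_of_sum_log_lt_quarter h3X hlt
  have hl1 : l ∉ S1 := fun hm => hlA (Finset.mem_union_left _ (Finset.mem_union_left _ hm))
  have hl2 : l ∉ S2 := fun hm => hlA (Finset.mem_union_left _ (Finset.mem_union_right _ hm))
  have hl3 : l ∉ S3 := fun hm => hlA (Finset.mem_union_right _ hm)
  refine ⟨l, hlp, ?_, hlle, ?_, ?_⟩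
  · -- (P1), lower bound: `l ∉ (S1)` means `l > ⌊√h⌋`
    have : ¬ (l ≤ ⌊Real.sqrt h⌋₊) := fun hm => hl1 (by rw [hS1, Nat.mem_primesLE]; exact ⟨hm, hlp⟩)
    have hlt' : ⌊Real.sqrt h⌋₊ < l := by omega
    exact (Nat.lt_of_floor_lt hlt').le
  · -- (P2): `l ∣ h_v ≠ 0` ⟹ `h_v ≥ √h` excluded by (S2′), `h_v < √h` forces `l ≤ h_v < √h`, excluded by (S1)
    intro v hvV hne hdvd
    rcases le_or_gt (Real.sqrt h) (hv v) with hge | hlt''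
    · exact hl2 (by
        rw [hS2, Finset.mem_biUnion]
        exact ⟨v, by rw [hW, Finset.mem_filter]; exact ⟨hvV, hge⟩, Nat.mem_primeFactors.mpr ⟨hlp, hdvd, hne⟩⟩)
    · have hle : (l : ℝ) ≤ hv v := by exact_mod_cast Nat.le_of_dvd (Nat.pos_of_ne_zero hne) hdvd
      have : l ≤ ⌊Real.sqrt h⌋₊ := Nat.le_floor (by linarith)
      exact hl1 (by rw [hS1, Nat.mem_primesLE]; exact ⟨this, hlp⟩)
  · -- (P3)
    intro v hvV hpl
    by_contra hge
    rw [not_lt] at hge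
    exact hl3 (by rw [hS3, Finset.mem_image]; exact ⟨v, by rw [hW, Finset.mem_filter]; exact ⟨hvV, hge⟩, hpl⟩)

end CarrierFree

/-! ## At an NF-point: the effective twin of `exists_prime_P1_P2_P3_point` -/

open scoped Classical in
/-- **(P1), (P2), (P3) for the point `λ` — EFFECTIVE** (pp. 44–45, over `F_tpd`, bookkeeping as in
`exists_prime_P1_P2_P3_point`: `V` = the bad places of `λ`, `h_v = max(0, −ord_v j(λ))`, `f_v`, `p_v`, `[F_tpd:ℚ] ≤ d ≤ δ =
2^{12}·3^3·5·d`, `h = log(q^∀(λ))`): under ONLY `5 ≤ (log q^∀(λ))^{1/2}` — no `ξ_prm` — there is a prime `l` with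
(P1) `h^{1/2} ≤ l ≤ 10δ·h^{1/2}·log(2δ·h)`, (P2) `CondP2`, (P3) `p_v = l ⟹ h_v < h^{1/2}`. [claim: Mochizuki2012, status: disputed] -/
theorem exists_prime_P1_P2_P3_point_of_five_le_sqrt (P : NFPoint) {d : ℕ} (hdeg : P.degree ≤ d)
    (h5 : 5 ≤ Real.sqrt (logQForall P)) :
    ∃ l : ℕ, l.Prime ∧ Real.sqrt (logQForall P) ≤ l ∧
      (l : ℝ) ≤ 10 * delta d * Real.sqrt (logQForall P) * Real.log (2 * delta d * logQForall P) ∧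
      CondP2 P l ∧
      ∀ v ∈ badPlaces P, residueChar P.F v = l → localHeight P v < Real.sqrt (logQForall P) := by
  have hd1 : 1 ≤ d := le_trans P.degree_pos hdeg
  have hd1' : (1 : ℝ) ≤ d := by exact_mod_cast hd1
  have two_le : (2 : ℝ) ≤ delta d := by unfold delta; nlinarith
  have d_le : (P.degree : ℝ) ≤ delta d := by
    unfold delta
    have : (P.degree : ℝ) ≤ d := by exact_mod_cast hdeg
    nlinarith
  have h_def : (P.degree : ℝ) * logQForall P =
      ∑ v ∈ badPlaces P, ((-(ord P.F v (jInv P.x))).toNat : ℝ) * (resDeg P.F v : ℝ) * Real.log (residueChar P.F v) := by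
    rw [degree_mul_logQForall_eq_sum_logNorm]
    refine Finset.sum_congr rfl fun v _ => ?_
    unfold localHeight
    rw [logNorm_eq]
    ring
  obtain ⟨l, hl, hP1lo, hP1hi, hP2, hP3⟩ := exists_prime_P1_P2_P3_of_five_le_sqrt
    (V := badPlaces P) (hv := fun v => (-(ord P.F v (jInv P.x))).toNat) (fv := fun v => resDeg P.F v)
    (pv := fun v => residueChar P.F v)
    (fun v _ => Nat.pos_of_ne_zero (resDeg_ne_zero P.F v)) (fun v _ => residueChar_prime P.F v) two_le d_le h_def h5
  refine ⟨l, hl, hP1lo, hP1hi, ?_, ?_⟩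
  · intro v hv hdvd
    have hvb : v ∈ badPlaces P := (mem_badPlaces_iff_ord_neg P v).mpr hv
    have hne : (-(ord P.F v (jInv P.x))).toNat ≠ 0 := by
      intro h0; rw [Int.toNat_eq_zero] at h0; omega
    apply hP2 v hvb hne
    have hcast : (((-(ord P.F v (jInv P.x))).toNat : ℕ) : ℤ) = -(ord P.F v (jInv P.x)) :=
      Int.toNat_of_nonneg (by omega)
    have : (l : ℤ) ∣ (((-(ord P.F v (jInv P.x))).toNat : ℕ) : ℤ) := by
      rw [hcast]; exact dvd_neg.mpr hdvd
    exact_mod_cast this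
  · intro v hv hres
    exact hP3 v hv hres

end Cor22

end Literature.IUT.LogVolume

end
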